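import Summits.RiemannHypothesis.RiemannHypothesis.Theorems.TiltedLandingLaw421R3Lens1Meridian
import Summits.RiemannHypothesis.RiemannHypothesis.Theorems.TiltedLandingLaw421R3Lens1MeridianBase
import Summits.RiemannHypothesis.RiemannHypothesis.Theorems.TiltedLandingLaw421R3Lens1MeridianCrit

/-!
# IMAGE «Lens1MeridianLift» v1 (lens-1 g12) — (B1) `MeridianTrichotomyLaw` of #172 PROVED; stub 1′(θ) ⟸ (B2)(θ) ALONE

Assembly of the lift (G) from the local lemmas of #180 «Lens1MeridianLocal» and the offers «Lens1MeridianGerm» ((L3), (L8)),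
«Lens1MeridianOrd» ((L1m)), «Lens1MeridianBase» ((L6), (L7)), «Lens1MeridianCrit» ((L5)):
* `phi_not_locally_const` (NC): `φ = f^{(j+1)}/f^{(j)}` is nowhere locally constant off the zeros of `f^{(j)}` once `f^{(j)}` has a zero
  (identity theorem for `f^{(j+1)} − c·f^{(j)}`, then `f^{(j)}·e^{−cz}` is constant);
* `pay_im_large_near_upper_zero` (N1): pay points near an upper zero of `f^{(j)}` have arbitrarily large `Im φ` ((L1m));
* `meridianReach_of`: the (G) assembly from named hypotheses — minimise `Im φ` over the CLOSURE of the truncated component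
  `{z ∈ K, z ≠ T, Im φ z ≤ c}` (compact; `φ` continuous there since the truncation stays away from every zero of `f^{(j)}` by (N1), (L7)) and read
  the minimiser off: interior pay point ⇒ (L5) contradicts minimality; interior/arc point with `φ = 0` ⇒ nested zero of `f^{(j+1)}` (PinnedTopAt (a));
  arc pay point ⇒ EXIT; base point ⇒ `f^{(j+1)}(x) = 0` with the NL sign forced by (L6) (PinnedTopAt (b));
* `meridian_reach`: (G) for `f` entire, real on `ℝ`, `T` a simple upper zero of `f^{(j)}`;
* `meridianTrichotomyLaw : MeridianTrichotomyLaw` — #172's (B1) is now a THEOREM; hence `topPinningTol_of_noExitOrPartner`: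
  stub 1′(θ) `TopPinningTol θ` ⟸ (B2)(θ) `NoExitOrPartnerLaw θ` ALONE (`θ ≥ 0`), in particular at `θ = 1/10`.
HONEST STATUS: (B2)(1/10) is UNDECIDED and asserted by nothing; stub 1′, ⟨27010⟩ and RH stay OPEN; nothing here asserts an open law.
-/

namespace RhW08.Lens1MeridianLift

open Complex Set Metric Literature.Analysis.Complex RhIdea6.G17.W07C7 RhW08.QuadW RhW08.Lens1TopChild RhW08.Lens1ArcSign
open RhW08.Lens1PinningTol RhW08.Lens1Meridian RhW08.Lens1MeridianLocal RhW08.Lens1MeridianGerm RhW08.Lens1MeridianOrd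
open RhW08.Lens1MeridianBase RhW08.Lens1MeridianCrit

/-- (NC) `φ` is not locally constant off the zeros of `f^{(j)}` once `f^{(j)}` has a zero. -/
theorem phi_not_locally_const (f : ℂ → ℂ) (j : ℕ) (T z₀ : ℂ) (hf : Differentiable ℂ f) (hT : iteratedDeriv j f T = 0)
    (hne : iteratedDeriv j f z₀ ≠ 0) : ¬ (∀ᶠ z in nhds z₀, phiAt f j z = phiAt f j z₀) := by
  intro hlc
  set G := iteratedDeriv j f with hGdef
  set c := phiAt f j z₀ with hcdef
  have hGd : Differentiable ℂ G := differentiable_iteratedDeriv_of_entire hf j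
  have hG'd : Differentiable ℂ (deriv G) := by rw [hGdef, ← iteratedDeriv_succ]; exact differentiable_iteratedDeriv_of_entire hf _
  have hGnz : ∀ᶠ z in nhds z₀, G z ≠ 0 := hGd.continuous.continuousAt.eventually_ne hne
  set H : ℂ → ℂ := fun z => deriv G z - c * G z with hHdef
  have hHd : Differentiable ℂ H := hG'd.sub (hGd.const_mul c)
  have hH0 : H =ᶠ[nhds z₀] 0 := by
    filter_upwards [hlc, hGnz] with z hz hGz
    have h : deriv G z / G z = c := hz
    rw [div_eq_iff hGz] at h
    show deriv G z - c * G z = 0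
    rw [h]; ring
  have hHz : ∀ z, H z = 0 := fun z =>
    (AnalyticOnNhd.eqOn_zero_of_preconnected_of_eventuallyEq_zero (fun w _ => hHd.analyticAt w) isPreconnected_univ
      (Set.mem_univ z₀) hH0) (Set.mem_univ z)
  set u : ℂ → ℂ := fun z => G z * exp (-(c * z)) with hudef
  have hu : ∀ z, HasDerivAt u 0 z := by
    intro z
    have h1 : HasDerivAt G (deriv G z) z := (hGd z).hasDerivAt
    have h2 : HasDerivAt (fun w : ℂ => exp (-(c * w))) (exp (-(c * z)) * (-(c * 1))) z :=
      ((hasDerivAt_id z).const_mul c).neg.cexp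
    have h3 := h1.mul h2
    have e : deriv G z * exp (-(c * z)) + G z * (exp (-(c * z)) * -(c * 1)) = 0 := by
      have := hHz z; simp only [hHdef] at this
      linear_combination exp (-(c * z)) * this
    rwa [e] at h3
  have hud : Differentiable ℂ u := fun z => (hu z).differentiableAt
  have hconst := is_const_of_deriv_eq_zero hud (fun z => (hu z).deriv) T z₀
  have h0 : u T = 0 := by show G T * exp (-(c * T)) = 0; rw [hT, zero_mul]
  rw [h0] at hconst
  have : G z₀ * exp (-(c * z₀)) = 0 := hconst.symm
  rcases mul_eq_zero.mp this with h | h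
  · exact hne h
  · exact Complex.exp_ne_zero _ h

/-- (N1) from (L1m) `poleVerticalGraph_ord`: near an upper zero `T'` of `f^{(j)}` (any order), pay points have arbitrarily large `Im φ`. -/
theorem pay_im_large_near_upper_zero (f : ℂ → ℂ) (j : ℕ) (T' : ℂ) (hf : Differentiable ℂ f)
    (hT' : iteratedDeriv j f T' = 0) (hq : 0 < T'.im) (hne : ∃ w, iteratedDeriv j f w ≠ 0) (c : ℝ) :
    ∃ r : ℝ, 0 < r ∧ ∀ z ∈ ball T' r, z ≠ T' → (phiAt f j z).re = 0 → 0 < (phiAt f j z).im → c < (phiAt f j z).im := by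
  obtain ⟨r, hr, X, -, -, hbelow, habove⟩ := poleVerticalGraph_ord f j T' hf hT' hq hne
  have hc1 : 0 < |c| + 1 := by positivity
  refine ⟨min r (1 / (4 * (|c| + 1))), lt_min hr (by positivity), ?_⟩
  intro z hz hzT hre hpos
  rw [Metric.mem_ball, dist_eq_norm] at hz
  have hzr : ‖z - T'‖ < r := lt_of_lt_of_le hz (min_le_left _ _)
  have hzc : ‖z - T'‖ < 1 / (4 * (|c| + 1)) := lt_of_lt_of_le hz (min_le_right _ _)
  have hx : |z.re - T'.re| ≤ r := by
    have := abs_re_le_norm (z - T'); rw [Complex.sub_re] at this; linarith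
  have hyabs : |z.im - T'.im| ≤ ‖z - T'‖ := by have := abs_im_le_norm (z - T'); rwa [Complex.sub_im] at this
  have hy1 : T'.im - r ≤ z.im := by have := neg_abs_le (z.im - T'.im); linarith
  have hy2 : z.im ≤ T'.im + r := by have := le_abs_self (z.im - T'.im); linarith
  have hz_eta : (⟨z.re, z.im⟩ : ℂ) = z := Complex.eta z
  rcases le_or_gt T'.im z.im with hy | hy
  · have h := habove z.re z.im hx hy hy2 (by rw [hz_eta]; exact hzT) (by rw [hz_eta]; exact hre)
    rw [hz_eta] at h; exact absurd hpos (lt_asymm h)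
  · obtain ⟨-, -, -, hIm, huniq⟩ := hbelow z.im hy1 hy
    have hxX : z.re = X z.im := huniq z.re hx (by rw [hz_eta]; exact hre)
    have hφz : phiAt f j z = phiAt f j ⟨X z.im, z.im⟩ := by rw [← hxX, hz_eta]
    rw [hφz]
    refine lt_of_lt_of_le ?_ hIm
    have hqy : 0 < T'.im - z.im := by linarith
    have hqy2 : T'.im - z.im < 1 / (4 * (|c| + 1)) := by
      have := neg_abs_le (z.im - T'.im); linarith
    have h4 : 4 * (T'.im - z.im) < 1 / (|c| + 1) := by
      have e : 1 / (|c| + 1) = 4 * (1 / (4 * (|c| + 1))) := by field_simp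
      rw [e]; linarith
    rw [lt_div_iff₀ (by positivity)]
    calc c * (4 * (T'.im - z.im)) ≤ |c| * (4 * (T'.im - z.im)) := mul_le_mul_of_nonneg_right (le_abs_self c) (by positivity)
      _ ≤ |c| * (1 / (|c| + 1)) := mul_le_mul_of_nonneg_left h4.le (abs_nonneg c)
      _ < 1 := by rw [mul_one_div, div_lt_one hc1]; linarith

/-- (G) ASSEMBLY of the lift from the local lemmas (hypotheses = the statements proved in the lens-1 g12 offers, by name in the docstring
of each binder). -/
theorem meridianReach_of (f : ℂ → ℂ) (j : ℕ) (T : ℂ) (hf : Differentiable ℂ f) (hreal : ∀ x : ℝ, (f x).im = 0)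
    (hT : iteratedDeriv j f T = 0) (hq : 0 < T.im)
    -- (L3) `meridianComponent_nontrivial`
    (germ : ∃ z ∈ meridianComponent f j T, z ≠ T)
    -- (N1) from (L1m) `poleVerticalGraph_ord`: pay points near an upper zero have large `Im φ`
    (N1 : ∀ T' : ℂ, iteratedDeriv j f T' = 0 → 0 < T'.im → ∀ c : ℝ, ∃ r : ℝ, 0 < r ∧ ∀ z ∈ ball T' r, z ≠ T' →
      (phiAt f j z).re = 0 → 0 < (phiAt f j z).im → c < (phiAt f j z).im)
    -- (L7) `im_phi_neg_near_real_zero`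
    (N2 : ∀ x₀ : ℝ, iteratedDeriv j f x₀ = 0 → ∃ r : ℝ, 0 < r ∧ ∀ z ∈ ball (x₀ : ℂ) r, 0 < z.im → (phiAt f j z).im < 0)
    -- (L6) `im_phi_neg_near_repelling_base_crit`
    (N3 : ∀ x₀ : ℝ, iteratedDeriv j f x₀ ≠ 0 → iteratedDeriv (j + 1) f x₀ = 0 →
      (iteratedDeriv j f x₀).re * (iteratedDeriv (j + 2) f x₀).re < 0 →
      ∃ r : ℝ, 0 < r ∧ ∀ z ∈ ball (x₀ : ℂ) r, 0 < z.im → (phiAt f j z).im < 0)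
    -- (L8) `mem_meridianComponent_of_mem_closure`
    (L8 : ∀ z ∈ paySet f j T, z ∈ closure (meridianComponent f j T) → z ∈ meridianComponent f j T)
    -- (L5) `critical_descent`
    (L5 : ∀ z₀ ∈ meridianComponent f j T, z₀ ≠ T → (z₀.re - T.re) ^ 2 + z₀.im ^ 2 < T.im ^ 2 → 0 < z₀.im →
      AnalyticAt ℂ (phiAt f j) z₀ → ¬ (∀ᶠ z in nhds z₀, phiAt f j z = phiAt f j z₀) →
      ∃ z ∈ meridianComponent f j T, 0 < (phiAt f j z).im ∧ (phiAt f j z).im < (phiAt f j z₀).im)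
    -- (NC) `φ` is not locally constant off the zeros of `f^{(j)}`
    (NC : ∀ z₀ : ℂ, iteratedDeriv j f z₀ ≠ 0 → ¬ (∀ᶠ z in nhds z₀, phiAt f j z = phiAt f j z₀)) :
    PinnedTopAt f j T ∨ ∃ m ∈ meridianComponent f j T, m ≠ T ∧ (m.re - T.re) ^ 2 + m.im ^ 2 = T.im ^ 2 ∧ 0 < m.im := by
  set G := iteratedDeriv j f with hGdef
  set φ := phiAt f j with hφdef
  set K := meridianComponent f j T with hKdef
  have hGd : Differentiable ℂ G := differentiable_iteratedDeriv_of_entire hf j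
  have hG'd : Differentiable ℂ (deriv G) := by rw [hGdef, ← iteratedDeriv_succ]; exact differentiable_iteratedDeriv_of_entire hf _
  have hS := Literature.NumberTheory.LFunctions.iteratedDeriv_conj_of_conj (Literature.Analysis.Complex.apply_conj_eq_conj hf hreal)
  have hGreal : ∀ (n : ℕ) (x : ℝ), (iteratedDeriv n f x).im = 0 := fun n x => by
    have := hS n x; rw [conj_ofReal] at this; exact conj_eq_iff_im.mp this.symm
  have hφreal : ∀ x : ℝ, (φ x).im = 0 := fun x => by
    show (phiAt f j x).im = 0; unfold phiAt; rw [← iteratedDeriv_succ, Complex.div_im, hGreal, hGreal]; ring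
  have hφT : φ T = 0 := by show deriv G T / G T = 0; rw [hT, div_zero]
  -- pay-set facts
  have hKpay : ∀ z ∈ K, z ≠ T → ((z.re - T.re) ^ 2 + z.im ^ 2 ≤ T.im ^ 2 ∧ 0 ≤ z.im) ∧ (φ z).re = 0 ∧ 0 < (φ z).im := by
    intro z hz hzT
    rcases connectedComponentIn_subset _ _ hz with h | h
    · exact h
    · exact absurd (Set.mem_singleton_iff.mp h) hzT
  have hnoreal : ∀ z ∈ K, z ≠ T → z.im = 0 → False := by
    intro z hz hzT hy
    have h := (hKpay z hz hzT).2.2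
    have : z = ((z.re : ℝ) : ℂ) := Complex.ext rfl (by rw [hy, Complex.ofReal_im])
    rw [this, hφreal] at h; exact lt_irrefl _ h
  -- no truncated-component point in a ball where `Im φ < 0` above the axis
  have hball_empty : ∀ (x₀ r : ℝ), (∀ z ∈ ball (x₀ : ℂ) r, 0 < z.im → (φ z).im < 0) →
      ∀ z ∈ K, z ≠ T → z ∈ ball (x₀ : ℂ) r → False := by
    intro x₀ r hneg z hz hzT hzb
    have hp := hKpay z hz hzT
    rcases hp.1.2.lt_or_eq with hy | hy
    · exact lt_asymm hp.2.2 (hneg z hzb hy)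
    · exact hnoreal z hz hzT hy.symm
  -- the truncated component and its closure
  obtain ⟨z₁, hz₁, hz₁T⟩ := germ
  set c := (φ z₁).im with hcdef
  set Kc : Set ℂ := {z | z ∈ K ∧ z ≠ T ∧ (φ z).im ≤ c} with hKc
  set E := closure Kc with hEdef
  have hz₁Kc : z₁ ∈ Kc := ⟨hz₁, hz₁T, le_rfl⟩
  have hD : IsClosed {z : ℂ | (z.re - T.re) ^ 2 + z.im ^ 2 ≤ T.im ^ 2 ∧ 0 ≤ z.im} :=
    (isClosed_le (((Complex.continuous_re.sub continuous_const).pow 2).add (Complex.continuous_im.pow 2)) continuous_const).inter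
      (isClosed_le continuous_const Complex.continuous_im)
  have hED : E ⊆ {z : ℂ | (z.re - T.re) ^ 2 + z.im ^ 2 ≤ T.im ^ 2 ∧ 0 ≤ z.im} :=
    closure_minimal (fun z hz => (hKpay z hz.1 hz.2.1).1) hD
  have hEball : E ⊆ closedBall ((T.re : ℝ) : ℂ) T.im := by
    intro z hz
    have h := (hED hz).1
    rw [Metric.mem_closedBall, dist_eq_norm]
    have h2 : ‖z - (T.re : ℂ)‖ ^ 2 ≤ T.im ^ 2 := by
      rw [Complex.sq_norm, Complex.normSq_apply, Complex.sub_re, Complex.sub_im, Complex.ofReal_re, Complex.ofReal_im, sub_zero]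
      nlinarith
    have h3 := abs_le_of_sq_le_sq h2 hq.le
    rwa [abs_of_nonneg (norm_nonneg _)] at h3
  have hEc : IsCompact E := (isCompact_closedBall _ _).of_isClosed_subset isClosed_closure hEball
  have hEK : E ⊆ closure K := closure_mono fun z hz => hz.1
  -- `f^{(j)} ≠ 0` on `E`
  have hGE : ∀ e ∈ E, G e ≠ 0 := by
    intro e he hGe
    rcases (hED he).2.lt_or_eq with hy | hy
    · obtain ⟨r, hr, hN⟩ := N1 e hGe hy c
      obtain ⟨z, hzKc, hze⟩ := Metric.mem_closure_iff.mp he r hr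
      have hp := hKpay z hzKc.1 hzKc.2.1
      have hzne : z ≠ e := by
        intro h; rw [h] at hp
        have : φ e = 0 := by show deriv G e / G e = 0; rw [hGe, div_zero]
        rw [this, Complex.zero_im] at hp; exact lt_irrefl _ hp.2.2
      have := hN z (by rw [Metric.mem_ball, dist_comm]; exact hze) hzne hp.2.1 hp.2.2
      linarith [hzKc.2.2]
    · have he' : e = ((e.re : ℝ) : ℂ) := Complex.ext rfl (by rw [← hy, Complex.ofReal_im])
      obtain ⟨r, hr, hN⟩ := N2 e.re (by rw [← he']; exact hGe)
      obtain ⟨z, hzKc, hze⟩ := Metric.mem_closure_iff.mp he r hr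
      exact hball_empty e.re r hN z hzKc.1 hzKc.2.1 (by rw [Metric.mem_ball, dist_comm, ← he']; exact hze)
  -- `Im φ` is continuous on `E` and attains its minimum
  have hφcont : ∀ e ∈ E, ContinuousAt φ e := fun e he =>
    (hG'd.continuous.continuousAt).div (hGd.continuous.continuousAt) (hGE e he)
  have hcont : ContinuousOn (fun z => (φ z).im) E := fun e he =>
    (Complex.continuous_im.continuousAt.comp (hφcont e he)).continuousWithinAt
  obtain ⟨w, hwE, hmin⟩ := hEc.exists_isMinOn ⟨z₁, subset_closure hz₁Kc⟩ hcont
  rw [isMinOn_iff] at hmin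
  have hGw : G w ≠ 0 := hGE w hwE
  have hwT : w ≠ T := fun h => hGw (by rw [h]; exact hT)
  -- `Re φ w = 0`, `0 ≤ Im φ w ≤ c`
  have hcl : φ w ∈ closure (φ '' Kc) := (hφcont w hwE).continuousWithinAt.mem_closure_image hwE
  have hclosed : IsClosed {u : ℂ | u.re = 0 ∧ 0 ≤ u.im} :=
    (isClosed_eq Complex.continuous_re continuous_const).inter (isClosed_le continuous_const Complex.continuous_im)
  have hwri : (φ w).re = 0 ∧ 0 ≤ (φ w).im := by
    have hsub : φ '' Kc ⊆ {u : ℂ | u.re = 0 ∧ 0 ≤ u.im} := by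
      rintro u ⟨z, hz, rfl⟩; have hp := hKpay z hz.1 hz.2.1; exact ⟨hp.2.1, hp.2.2.le⟩
    exact closure_minimal hsub hclosed hcl
  have hwc : (φ w).im ≤ c := hmin z₁ (subset_closure hz₁Kc)
  have hwD := hED hwE
  -- the zero branch: `φ w = 0` ⇒ nested zero of `f^{(j+1)}` (if `Im w > 0`)
  have hzeroN : (φ w).im = 0 → 0 < w.im → PinnedTopAt f j T := by
    intro him hy
    have hφ0 : φ w = 0 := Complex.ext hwri.1 him
    have hG' : iteratedDeriv (j + 1) f w = 0 := by
      have : deriv G w / G w = 0 := hφ0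
      rcases div_eq_zero_iff.mp this with h | h
      · rw [iteratedDeriv_succ]; exact h
      · exact absurd h hGw
    exact Or.inl ⟨w, hG', hy.ne', hwD.1⟩
  rcases hwD.2.lt_or_eq with hy | hy
  · -- `Im w > 0`
    rcases hwri.2.lt_or_eq with ht | ht
    · -- `t⋆ > 0`: `w` is a pay point, hence in `K`
      have hwpay : w ∈ paySet f j T := Or.inl ⟨hwD, hwri.1, ht⟩
      have hwK : w ∈ K := L8 w hwpay (hEK hwE)
      rcases hwD.1.lt_or_eq with hd | hd
      · -- interior: critical descent contradicts minimality
        exfalso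
        have ha : AnalyticAt ℂ φ w := by
          have : φ = deriv G / G := by funext z; rfl
          rw [this]; exact (hGd.analyticAt _).deriv.div (hGd.analyticAt _) hGw
        obtain ⟨z, hzK, hzpos, hzlt⟩ := L5 w hwK hwT hd hy ha (NC w hGw)
        have hzT : z ≠ T := fun h => by rw [h, hφT, Complex.zero_im] at hzpos; exact lt_irrefl _ hzpos
        have hzKc : z ∈ Kc := ⟨hzK, hzT, by linarith⟩
        linarith [hmin z (subset_closure hzKc)]
      · -- on the arc: EXIT
        exact Or.inr ⟨w, hwK, hwT, hd, hy⟩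
    · exact Or.inl (hzeroN ht.symm hy)
  · -- `Im w = 0`: base point, `φ w` real ⇒ `φ w = 0` ⇒ base critical point; (L6) forces the NL sign
    have hw' : w = ((w.re : ℝ) : ℂ) := Complex.ext rfl (by rw [← hy, Complex.ofReal_im])
    have him : (φ w).im = 0 := by rw [hw']; exact hφreal _
    have hφ0 : φ w = 0 := Complex.ext hwri.1 him
    have hGx : iteratedDeriv j f (w.re : ℝ) ≠ 0 := by rw [← hw']; exact hGw
    have hG'x : iteratedDeriv (j + 1) f (w.re : ℝ) = 0 := by
      have : deriv G w / G w = 0 := hφ0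
      rcases div_eq_zero_iff.mp this with h | h
      · rw [iteratedDeriv_succ, ← hw']; exact h
      · exact absurd h hGw
    have hsign : 0 ≤ (iteratedDeriv j f (w.re : ℝ)).re * (iteratedDeriv (j + 2) f (w.re : ℝ)).re := by
      by_contra hlt
      push Not at hlt
      obtain ⟨r, hr, hN⟩ := N3 w.re hGx hG'x hlt
      obtain ⟨z, hzKc, hze⟩ := Metric.mem_closure_iff.mp hwE r hr
      exact hball_empty w.re r hN z hzKc.1 hzKc.2.1 (by rw [Metric.mem_ball, dist_comm, ← hw']; exact hze)
    refine Or.inl (Or.inr ⟨w.re, ?_, ?_, ?_, hsign⟩)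
    · have h := hwD.1; rw [← hy] at h
      exact abs_le_of_sq_le_sq (by nlinarith) hq.le
    · rw [hG'x, Complex.zero_re]
    · intro h0; exact hGx (Complex.ext h0 (hGreal j _))

/-- (G) the LIFT for a simple upper zero `T` of `f^{(j)}`, `f` entire and real on `ℝ`. -/
theorem meridian_reach (f : ℂ → ℂ) (j : ℕ) (T : ℂ) (hf : Differentiable ℂ f) (hreal : ∀ x : ℝ, (f x).im = 0)
    (hT : iteratedDeriv j f T = 0) (hq : 0 < T.im) (hT' : iteratedDeriv (j + 1) f T ≠ 0) :
    PinnedTopAt f j T ∨ ∃ m ∈ meridianComponent f j T, m ≠ T ∧ (m.re - T.re) ^ 2 + m.im ^ 2 = T.im ^ 2 ∧ 0 < m.im := by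
  have hne : ∃ w, iteratedDeriv j f w ≠ 0 := by
    by_contra h
    push Not at h
    apply hT'
    have h0 : iteratedDeriv j f = fun _ => 0 := funext h
    rw [iteratedDeriv_succ, h0, deriv_const']
  refine meridianReach_of f j T hf hreal hT hq ?_ ?_ ?_ ?_ ?_ ?_ ?_
  · obtain ⟨z, hz, hzT, -⟩ := meridianComponent_nontrivial f j T hf hT hq hT'; exact ⟨z, hz, hzT⟩
  · intro T' hT'0 hq' c; exact pay_im_large_near_upper_zero f j T' hf hT'0 hq' hne c
  · intro x₀ hx₀; exact im_phi_neg_near_real_zero f j x₀ hf hreal hx₀ hne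
  · intro x₀ hG hG' hsign; exact im_phi_neg_near_repelling_base_crit f j x₀ hf hreal hG hG' hsign
  · intro z hz hcl; exact mem_meridianComponent_of_mem_closure f j T z hz hcl
  · intro z₀ hz₀ hzT hd hy ha hnc; exact critical_descent f j T z₀ hz₀ hzT hd hy ha hnc
  · intro z₀ hG; exact phi_not_locally_const f j T z₀ hf hT hG

/-- ★ (B1) of #172 «Lens1Meridian» is a THEOREM: on a legal frame (only `f` entire and real on `ℝ` is used), a simple upper zero `T` of `f^{(j)}` is
`PinnedTopAt f j T` or has a meridian exit point. -/
theorem meridianTrichotomyLaw : MeridianTrichotomyLaw := by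
  intro η f x₀ s hmax R Hs B hE j T hT hq hT'
  rcases meridian_reach f j T hE.1 hE.2.1 hT hq hT' with h | ⟨m, hm, hmT, hc, h0⟩
  · exact Or.inl h
  · refine Or.inr ⟨m, ⟨hc, h0, ?_⟩, ?_⟩
    · rcases (show m.im ≤ T.im by nlinarith [sq_nonneg (m.re - T.re)]).lt_or_eq with h1 | h1
      · exact h1
      · exfalso; apply hmT
        have hre : m.re = T.re := by nlinarith [sq_nonneg (m.re - T.re)]
        exact Complex.ext hre h1
    · rcases connectedComponentIn_subset _ _ hm with h | h
      · exact h.2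
      · exact absurd (Set.mem_singleton_iff.mp h) hmT

/-- ★ stub 1′(θ) ⟸ (B2)(θ) ALONE (`θ ≥ 0`; #172's exact glue with (B1) discharged) — in particular
`NoExitOrPartnerLaw (1/10) → TopPinningTol (1/10)`. -/
theorem topPinningTol_of_noExitOrPartner {θ : ℝ} (hθ : 0 ≤ θ) (h2 : NoExitOrPartnerLaw θ) : TopPinningTol θ :=
  topPinningTol_of_meridian hθ meridianTrichotomyLaw h2

/-- the registry instance: stub 1′ VERBATIM (`TopPinningTol (1/10)`) ⟸ (B2)(1/10). -/
theorem topPinningTol_tenth_of_noExitOrPartner (h2 : NoExitOrPartnerLaw (1 / 10)) : TopPinningTol (1 / 10) :=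
  topPinningTol_of_noExitOrPartner (by norm_num) h2

end RhW08.Lens1MeridianLift
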